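import Summits.Ventures.HSemireg.ComponentTransfer
import Literature.AlgebraicGeometry.HodgeTheory.BlochSemiregularSpreadGlobal
import Literature.AlgebraicGeometry.HodgeTheory.BlochSemiregularSpreadSmoothComponents
import HarnessLib

/-!
# Venture HSemireg — the transfer chain on a Hodge-locus component for a REDUCED local complete intersection with
# SMOOTH components (the STEP-0 class (A) object, Schoen's `Δ_J ∪ (C × C)`): composition of `ComponentTransfer.lean`
# (theory seat 3) with the named fact `BlochSemiregularSpreadSmoothComponents` (Bloch 1972 (7.4)/(7.5))

HONEST FRAMING. Assembly file of the computation cell `pub-hsemireg` (Lean seat p3, composition duty); nothing about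
any explicit variety is asserted and nothing here says that the Hodge conjecture (or its CM case) holds: every theorem
carries its inputs BY NAME. `ComponentTransfer.lean` proves «a Hodge class `α₀` on ONE fibre is supported on an
INTEGRAL Bloch-semiregular local complete intersection ⟹ algebraic on the whole swept set / Hodge-locus component»,
modulo `BlochSemiregularSpread n p` (whose integrality hypothesis pins the class by support + purity). The cell's
certified STEP-0 object is REDUCIBLE — Schoen's `Z = Δ_J ∪ (C × C) ⊂ J(C)²`, two smooth surfaces meeting cleanly along
the diagonal curve (`rank π = 12 = h¹(Z, 𝒩_Z)`, three independent exact codes) — so this file re-runs the same two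
compositions with the sibling fact `BlochSemiregularSpreadSmoothComponents n p` (`Literature/…/BlochSemiregularSpreadSmoothComponents.lean`,
Bloch (7.4)/(7.5) = Buchweitz–Flenner Thm. 5.2 for a REDUCED lci whose components are images of SMOOTH projective
`K_j`, class pinned by the tree's REAL fundamental class `Σ_j ι_{j*}1`, complex orientations):

* `blochSemiregularSpreadSmoothComponents_forall_mem_algebraicClasses` — the GLOBAL form over an irreducible base
  (Bloch p. 65, last paragraph: the fact's open set of algebraicity + the tree's PROVED algebraicity-locus theorem
  `charlesSchnell_algebraicityLocus_iUnion_closed`, via `….forall_mem_algebraicClasses_of_isOpen` of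
  `BlochSemiregularSpreadGlobal.lean`) — sibling of `BlochSemiregularSpread.forall_mem_algebraicClasses`.
* `forall_mem_algebraicClasses_of_sweepsClasses_of_unionSeed` — th-3's chart form with the reducible seed: a chart
  `(f, W)` sweeping a set `A` of fibre classes of `g`, one `x₀ ∈ A` whose class is `μ·Σ_j [K_j]` (`μ ∈ ℚ^×`) for a
  reduced Bloch-semiregular lci `Z ↪ 𝒴_{x₀.pt}` with smooth components `K_j` ⟹ every class of `A` is algebraic.
* `hc_on_component_of_unionSeed` — the component form (`A = C.carrier`, `C : HodgeLocusComponent g n p`).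

Not here (as in `ComponentTransfer.lean`): the existence of the chart (Cattani–Deligne–Kaplan + Hironaka; hypothesis
`hsweep`), singular components, non-reduced `Z`.

References: [Bloch1972Semiregularity] Thm. (7.4) with proof p. 65, Remark (7.5); [BuchweitzFlenner2003] Thm. 5.2;
[CattaniDeligneKaplan1995JAMS] Thm. 1.1, Cor. 1.2; [CharlesSchnell2014Notes] Prop. 11.3.11; [Fulton1998] §1.5, §19.1;
C. Schoen, Compositio Math. 65 (1988) (the cycle).
-/

noncomputable section

open CategoryTheory AlgebraicGeometry Set
open Literature.AlgebraicGeometry.Motives Literature.AlgebraicGeometry.HodgeTheory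
open Literature.AlgebraicTopology.SingularHomology

namespace Summit.Ventures.HSemireg

local notation3 (prettyPrint := false) "Res[" f ", " s ", " k ", " A "]" =>
  complexBetti.map (Literature.AlgebraicGeometry.Motives.fiberι f s) k A

/-! ## The global form of the reducible-lci fact over an irreducible base -/

section Global

variable {𝒳 S : SchemeOver ℂ}

/-- **Bloch 1972 (7.4), class level, GLOBAL over an irreducible base, for a reduced lci with smooth components.**
The named fact `BlochSemiregularSpreadSmoothComponents n p` gives an open neighbourhood of `s₀` on which `W|_{𝒳_t}` is
algebraic; the tree's PROVED structure theorem on algebraicity loci (`charlesSchnell_algebraicityLocus_iUnion_closed`,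
a countable union of Zariski-closed sets) and Baire spread it to EVERY `t ∈ S(ℂ)` when `S` is irreducible — Bloch's
«simple argument using the Hilbert scheme … Since `U ⊂ T`, it follows that `T = S`». Binders = those of the fact plus
`IrreducibleSpace S.left`. [cite: Bloch1972Semiregularity, Thm. (7.4) and its proof, last paragraph (p. 65)]
[cite: BuchweitzFlenner2003, Thm. 5.2] [cite: CharlesSchnell2014Notes, Prop. 11.3.11 (proof)] -/
theorem blochSemiregularSpreadSmoothComponents_forall_mem_algebraicClasses {n p : ℕ}
    (hB : BlochSemiregularSpreadSmoothComponents n p) (hCS : charlesSchnell_algebraicityLocus_iUnion_closed)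
    (m : ℕ) (hmn : m + p = n) (X₀ : SchemeOver ℂ) (hX₀ : IsSmoothProjective n X₀)
    (r : ℕ) (K : Fin r → SchemeOver ℂ) (hK : ∀ j, IsSmoothProjective m (K j)) (ι : ∀ j, K j ⟶ X₀)
    (Z : Scheme.{0}) (i : Z ⟶ X₀.left) (f : 𝒳 ⟶ S) (s₀ : ComplexPoints S) (e : X₀ ≅ fiberOver f s₀)
    (W : complexBetti 𝒳 (2 * p))
    (hι : ∀ j, IsClosedImmersion (ι j).left)
    (hdist : ∀ j j', Set.range (ι j).left.base = Set.range (ι j').left.base → j = j')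
    (hreg : IsRegularImmersionOfCodim i p) (hred : IsReduced Z)
    (hrange : Set.range i.base = ⋃ j, Set.range (ι j).left.base) (hsr : IsBlochSemiregular i n p)
    (hf : IsSmoothProjectiveFamily f n) (h𝒳 : IsQuasiProjectiveOver 𝒳) (hS : IsQuasiProjectiveOver S)
    (hSm : _root_.AlgebraicGeometry.Smooth S.hom) [IrreducibleSpace S.left]
    (hW : ∀ s : ComplexPoints S, IsRationalClass (Res[f, s, 2 * p, W]) ∧
      IsOfHodgeType n (fiberOver f s) (2 * p) p p (Res[f, s, 2 * p, W]))
    (hWx : complexBetti.map e.hom (2 * p) (Res[f, s₀, 2 * p, W]) =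
      ∑ j, smoothSubvarietyClass hmn (hK j) hX₀ (ι j))
    (t : ComplexPoints S) : Res[f, t, 2 * p, W] ∈ algebraicClasses (fiberOver f t) p := by
  obtain ⟨U, hU, hs₀, hUA⟩ :=
    hB m hmn X₀ hX₀ r K hK ι Z i 𝒳 S f s₀ e W hι hdist hreg hred hrange hsr hf h𝒳 hS hSm hW hWx
  exact charlesSchnell_algebraicityLocus_iUnion_closed.forall_mem_algebraicClasses_of_isOpen hCS f n p h𝒳 hS hSm hf W
    hU ⟨s₀, hs₀⟩ hUA t

end Global

/-! ## The chart form and the component form with a reducible seed -/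

section Chart

variable {𝒴 M : SchemeOver ℂ} {g : 𝒴 ⟶ M} {𝒳 T : SchemeOver ℂ} {f : 𝒳 ⟶ T} {n p : ℕ}

/-- **Transfer along a chart from a REDUCED semiregular lci with smooth components.** Let `f : 𝒳 ⟶ T` be a smooth
projective family of relative dimension `n` (`𝒳`, `T` quasi-projective, `T` smooth irreducible) with a global class `W`
fibrewise rational of type `(p,p)`, sweeping a set `A` of fibre classes of `g : 𝒴 ⟶ M` (`SweepsClasses`, theory seat
3). Suppose ONE class `x₀ = (t₀, α₀) ∈ A` satisfies `α₀ = μ · Σ_j ι_{j*}1_{K_j}` (`μ ∈ ℚ`, `μ ≠ 0`) for smooth projective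
`m`-folds `K_j ↪ 𝒴_{t₀}` (`m + p = n`, pairwise distinct images) whose union is the support of a REDUCED local complete
intersection `i : Z ↪ 𝒴_{t₀}` of codimension `p` which is Bloch-semiregular. Then, granted
`BlochSemiregularSpreadSmoothComponents n p` (Bloch (7.4)/(7.5) for such `Z`), EVERY class of `A` is algebraic. Proof:
the chart point `u₀` over `x₀` and `e₀ : 𝒳_{u₀} ≅ 𝒴_{t₀}`; apply the global form to the class `μ⁻¹·W`, which is
fibrewise rational `(p,p)` and restricts through `e₀⁻¹` to `Σ_j [K_j]`; rescale; sweep.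
[cite: Bloch1972Semiregularity, Thm. (7.4), its proof p. 65, and Remark (7.5)] [cite: BuchweitzFlenner2003, Thm. 5.2]
[cite: CattaniDeligneKaplan1995JAMS, Thm. 1.1 and Cor. 1.2] -/
theorem forall_mem_algebraicClasses_of_sweepsClasses_of_unionSeed (hB : BlochSemiregularSpreadSmoothComponents n p)
    (hf : IsSmoothProjectiveFamily f n) (h𝒳 : IsQuasiProjectiveOver 𝒳) (hT : IsQuasiProjectiveOver T)
    (hTs : _root_.AlgebraicGeometry.Smooth T.hom) [IrreducibleSpace T.left]
    {W : complexBetti 𝒳 (2 * p)}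
    (hW : ∀ u : ComplexPoints T, IsRationalClass (Res[f, u, 2 * p, W]) ∧
      IsOfHodgeType n (fiberOver f u) (2 * p) p p (Res[f, u, 2 * p, W]))
    {A : Set (FiberClass g (2 * p))} (hsweep : SweepsClasses g f W A)
    {x₀ : FiberClass g (2 * p)} (hx₀ : x₀ ∈ A) (hX₀ : IsSmoothProjective n (fiberOver g x₀.pt))
    {m : ℕ} (hmn : m + p = n) {r : ℕ} (K : Fin r → SchemeOver ℂ) (hK : ∀ j, IsSmoothProjective m (K j))
    (ι : ∀ j, K j ⟶ fiberOver g x₀.pt) (hι : ∀ j, IsClosedImmersion (ι j).left)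
    (hdist : ∀ j j', Set.range (ι j).left.base = Set.range (ι j').left.base → j = j')
    {Z : Scheme.{0}} (i : Z ⟶ (fiberOver g x₀.pt).left) (hreg : IsRegularImmersionOfCodim i p)
    (hred : IsReduced Z) (hrange : Set.range i.base = ⋃ j, Set.range (ι j).left.base)
    (hsr : IsBlochSemiregular i n p) (μ : ℚ) (hμ : μ ≠ 0)
    (hcls : x₀.cls = ((μ : ℚ) : ℂ) • ∑ j, smoothSubvarietyClass hmn (hK j) hX₀ (ι j)) :
    ∀ x ∈ A, x.cls ∈ algebraicClasses (fiberOver g x.pt) p := by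
  obtain ⟨u₀, e₀, he₀⟩ := hsweep x₀ hx₀
  -- the rescaled global class `μ⁻¹ • W`: fibrewise rational `(p,p)`, anchored to `Σ_j [K_j]` through `e₀⁻¹`
  have hres : ∀ u : ComplexPoints T, Res[f, u, 2 * p, ((μ⁻¹ : ℚ) : ℂ) • W] = ((μ⁻¹ : ℚ) : ℂ) • Res[f, u, 2 * p, W] :=
    fun u => by rw [map_smul]
  have hW' : ∀ u : ComplexPoints T, IsRationalClass (Res[f, u, 2 * p, ((μ⁻¹ : ℚ) : ℂ) • W]) ∧
      IsOfHodgeType n (fiberOver f u) (2 * p) p p (Res[f, u, 2 * p, ((μ⁻¹ : ℚ) : ℂ) • W]) := fun u => by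
    rw [hres u]
    exact ⟨(hW u).1.smul μ⁻¹, (hW u).2.smul _⟩
  have hWx : complexBetti.map e₀.symm.hom (2 * p) (Res[f, u₀, 2 * p, ((μ⁻¹ : ℚ) : ℂ) • W]) =
      ∑ j, smoothSubvarietyClass hmn (hK j) hX₀ (ι j) := by
    rw [hres u₀, map_smul, ← he₀, Iso.symm_hom, e₀.complexBetti_map_inv_map_hom, hcls, smul_smul,
      ← Rat.cast_mul, inv_mul_cancel₀ hμ, Rat.cast_one, one_smul]
  have hall' : ∀ u : ComplexPoints T,
      Res[f, u, 2 * p, ((μ⁻¹ : ℚ) : ℂ) • W] ∈ algebraicClasses (fiberOver f u) p :=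
    blochSemiregularSpreadSmoothComponents_forall_mem_algebraicClasses hB
      charlesSchnell_algebraicityLocus_iUnion_closed_holds m hmn (fiberOver g x₀.pt) hX₀ r K hK ι Z i f u₀
      e₀.symm (((μ⁻¹ : ℚ) : ℂ) • W) hι hdist hreg hred hrange hsr hf h𝒳 hT hTs hW' hWx
  have hall : ∀ u : ComplexPoints T, Res[f, u, 2 * p, W] ∈ algebraicClasses (fiberOver f u) p := by
    intro u
    have h := Submodule.smul_mem _ ((μ : ℚ) : ℂ) (hall' u)
    rwa [hres u, smul_smul, ← Rat.cast_mul, mul_inv_cancel₀ hμ, Rat.cast_one, one_smul] at h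
  exact fun x hx => hsweep.mem_algebraicClasses hall hx

/-- **«HC on the Hodge-locus component through a point carrying a REDUCED semiregular representative with smooth
components»** — the component form (`A = C.carrier` for `C : HodgeLocusComponent g n p`) of
`forall_mem_algebraicClasses_of_sweepsClasses_of_unionSeed`; companion of theory seat 3's
`hc_on_component_of_semiregular_at_CM_point` (integral `Z`). INPUTS BY NAME: `BlochSemiregularSpreadSmoothComponents n p`
(refereed: Bloch (7.4)/(7.5), BF Thm. 5.2), the tree's proof of `charlesSchnell_algebraicityLocus_iUnion_closed`, and
the chart hypothesis `hsweep` (Cattani–Deligne–Kaplan). For the cell: `g` a universal polarised family of abelian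
fourfolds, `x₀` Schoen's point `(J(C)², (1/6)ω_K² + xΩ + x̄Ω̄)`, `K₁ = Δ_J`, `K₂ = C × C`.
[cite: Bloch1972Semiregularity, Thm. (7.4), its proof p. 65, and Remark (7.5)] [cite: BuchweitzFlenner2003, Thm. 5.2]
[cite: CattaniDeligneKaplan1995JAMS, Thm. 1.1 and Cor. 1.2] -/
theorem hc_on_component_of_unionSeed (hB : BlochSemiregularSpreadSmoothComponents n p)
    (C : HodgeLocusComponent g n p)
    (hf : IsSmoothProjectiveFamily f n) (h𝒳 : IsQuasiProjectiveOver 𝒳) (hT : IsQuasiProjectiveOver T)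
    (hTs : _root_.AlgebraicGeometry.Smooth T.hom) [IrreducibleSpace T.left]
    {W : complexBetti 𝒳 (2 * p)}
    (hW : ∀ u : ComplexPoints T, IsRationalClass (Res[f, u, 2 * p, W]) ∧
      IsOfHodgeType n (fiberOver f u) (2 * p) p p (Res[f, u, 2 * p, W]))
    (hsweep : SweepsClasses g f W C.carrier)
    {x₀ : FiberClass g (2 * p)} (hx₀ : x₀ ∈ C.carrier) (hX₀ : IsSmoothProjective n (fiberOver g x₀.pt))
    {m : ℕ} (hmn : m + p = n) {r : ℕ} (K : Fin r → SchemeOver ℂ) (hK : ∀ j, IsSmoothProjective m (K j))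
    (ι : ∀ j, K j ⟶ fiberOver g x₀.pt) (hι : ∀ j, IsClosedImmersion (ι j).left)
    (hdist : ∀ j j', Set.range (ι j).left.base = Set.range (ι j').left.base → j = j')
    {Z : Scheme.{0}} (i : Z ⟶ (fiberOver g x₀.pt).left) (hreg : IsRegularImmersionOfCodim i p)
    (hred : IsReduced Z) (hrange : Set.range i.base = ⋃ j, Set.range (ι j).left.base)
    (hsr : IsBlochSemiregular i n p) (μ : ℚ) (hμ : μ ≠ 0)
    (hcls : x₀.cls = ((μ : ℚ) : ℂ) • ∑ j, smoothSubvarietyClass hmn (hK j) hX₀ (ι j)) :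
    ∀ x ∈ C.carrier, x.cls ∈ algebraicClasses (fiberOver g x.pt) p :=
  forall_mem_algebraicClasses_of_sweepsClasses_of_unionSeed hB hf h𝒳 hT hTs hW hsweep hx₀ hX₀ hmn K hK ι hι hdist i
    hreg hred hrange hsr μ hμ hcls

end Chart

end Summit.Ventures.HSemireg

end
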